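import Literature.RepresentationTheory.TwistedCoinvariants
import Mathlib.RepresentationTheory.Subrepresentation
import HarnessLib

/-!
# Twisted coinvariants do not see a quotient on which the group acts through ANOTHER character

Topic `RepresentationTheory`; namespace `Literature.RepresentationTheory.TwistedCoinv` (continuing `TwistedCoinvariants`).
KERNEL ONLY: theorems, 0 definitions, 0 named facts, 0 `sorry`; pure algebra (Mathlib + `TwistedCoinvariants.lean`).

Let `ρ : Representation k H S` (`k` a field), `χ : H →* kˣ`, and let `S′ ≤ S` be a SUBREPRESENTATION such that `H` acts on
the quotient `S ⧸ S′` through a character `c` — i.e. `ρ h v − c h • v ∈ S′` for all `h, v`.  If `χ h₁ ≠ c h₁` for ONE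
element `h₁` whose operator `ρ h₁` commutes with `ρ(H)` (e.g. `h₁` central, or `H` commutative), then the inclusion
`S′ ↪ S` induces an ISOMORPHISM of `χ`-coinvariants

  `Coinv (ρ|S′) χ ≃ₗ[k] Coinv ρ χ`,  `[v′] ↦ [v′]`

(`exists_linearEquiv_coinv_subrepresentation_of_ne`).  Inverse: `[v] ↦ (χ h₁ − c h₁)⁻¹ • [ρ h₁ v − c h₁ • v]` — the vector
`ρ h₁ v − c h₁ • v` lies in `S′`, the map kills the relations `ρ h w − χ h • w` because `ρ h₁` commutes with `ρ h`, and on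
both sides `[ρ h₁ v − c h₁ • v] = (χ h₁ − c h₁) • [v]`.  In words: an extension `0 → S′ → S → Q → 0` with `Q`
`c`-isotypic changes the `χ`-coinvariants NEITHER by a quotient NOR by a kernel as soon as `χ ≠ c` on the centre — the
algebraic form of «`H₀(H, Q ⊗ χ⁻¹) = H₁(H, Q ⊗ χ⁻¹) = 0`», with no smoothness, compactness or characteristic hypothesis.

Also: `mk_subtype_surjective_of_ne` / the two halves separately, and `equivariant_of_comp_mk` — any such `e` with
`e ∘ mk = mk ∘ subtype` intertwines every pair of operators on the two coinvariant spaces that are induced by one operator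
of `S` preserving `S′` (e.g. `TwistedCoinv.rep` of a commuting representation preserving `S′`, by `rep_mk`).

Use (cell `hodgecm-mathlib`, fan B, row IV-3a `Liu2021.splitPlace_chiCoinv_iso_parabolicIndGL`, the split place of
[Liu2021, App. D, proof of Lem. D.1] = [MoeglinVignerasWaldspurger1987, Chap. 3 §III.7 a)]): `S = 𝒮(Fⁿ)` (Schwartz–Bruhat
functions on `Fⁿ`, `F` a non-archimedean local field), `S′ = {Φ | Φ 0 = 0} = 𝒮(Fⁿ ∖ 0)`, `H = Fˣ` (the centre of `GL_n`)
acting by homotheties twisted by a character, `Q = 𝒮(Fⁿ)⧸𝒮(Fⁿ∖0) ≅ ℂ` on which `Fˣ` acts through that character `c`; for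
a UNITARY `χ` one has `χ ϖ ≠ c ϖ` (`|c ϖ| = q^{∓n/2} ≠ 1`), so the `χ`-coinvariants of the oscillator representation are
those of `𝒮(Fⁿ ∖ 0)` — the «delta function at the origin» of [MVW87] III.7 contributes nothing, and
`𝒮(Fⁿ∖0)_χ ≅ Ind_{Q_{n-1,1}}^{GL_n}` ([MVW87] III.2–III.3) finishes.  HC_CM is proved only modulo the 7 printed citations
until rung 0 of the ladder closes; this file is unconditional.

## References
* [MoeglinVignerasWaldspurger1987] C. Mœglin, M.-F. Vignéras, J.-L. Waldspurger, LNM 1291 (1987), Chap. 3 §III.7 a)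
  (held chunk p0073 L12–L28: the `χ`-isotypic quotient of `𝒮(F^{m′})`, the point `0` versus `F^{m′} ∖ 0`).
* [BernsteinZelevinsky1976] I. N. Bernstein, A. V. Zelevinsky, Russian Math. Surveys 31:3 (1976), §2.3 (coinvariants,
  exactness properties).
-/

noncomputable section

namespace Literature.RepresentationTheory.TwistedCoinv

variable {k : Type*} [Field k] {H S : Type*} [Group H] [AddCommGroup S] [Module k S]
  (ρ : Representation k H S) (χ : H →* kˣ) (S' : Subrepresentation ρ)

/-- The restricted representation acts by `ρ` on underlying vectors (Mathlib's `Subrepresentation.toRepresentation` is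
`(ρ g).restrict _`). [folklore] -/
private theorem coe_toRepresentation_apply (h : H) (v' : S'.toSubmodule) :
    ((S'.toRepresentation h v' : S'.toSubmodule) : S) = ρ h v' :=
  rfl

/-- **The inclusion of a subrepresentation induces a map on `χ`-coinvariants**, `[v′] ↦ [v′]`; it is SURJECTIVE as soon
as `H` acts on `S ⧸ S′` through a character `c` with `χ h₁ ≠ c h₁` for some `h₁`:
`[v] = (χ h₁ − c h₁)⁻¹ • ([ρ h₁ v − χ h₁ • v] − [ρ h₁ v − c h₁ • v])`, the first bracket being a relation and the second a
vector of `S′`. [cite: MoeglinVignerasWaldspurger1987, Chap. 3 §III.7 a)] -/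
theorem mk_subtype_surjective_of_ne (c : H →* kˣ)
    (hquot : ∀ (h : H) (v : S), ρ h v - ((c h : kˣ) : k) • v ∈ S'.toSubmodule) {h₁ : H} (hne : χ h₁ ≠ c h₁) :
    ∀ x : Coinv ρ χ, ∃ v' : S'.toSubmodule, mk ρ χ (v' : S) = x := by
  intro x
  obtain ⟨v, rfl⟩ := mk_surjective ρ χ x
  have hd : ((χ h₁ : kˣ) : k) - ((c h₁ : kˣ) : k) ≠ 0 := by
    rw [sub_ne_zero]
    exact fun h => hne (Units.ext h)
  refine ⟨(((χ h₁ : kˣ) : k) - ((c h₁ : kˣ) : k))⁻¹ • ⟨ρ h₁ v - ((c h₁ : kˣ) : k) • v, hquot h₁ v⟩, ?_⟩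
  rw [Submodule.coe_smul, map_smul]
  change (((χ h₁ : kˣ) : k) - ((c h₁ : kˣ) : k))⁻¹ • mk ρ χ (ρ h₁ v - ((c h₁ : kˣ) : k) • v) = mk ρ χ v
  rw [map_sub, map_smul, mk_ρW, ← sub_smul, smul_smul, inv_mul_cancel₀ hd, one_smul]

/-- **Twisted coinvariants do not see a quotient with another character.**  Let `S′` be a subrepresentation of
`ρ : Representation k H S` such that `H` acts on `S ⧸ S′` through the character `c` (`ρ h v − c h • v ∈ S′`), and let
`h₁ ∈ H` have `ρ h₁` commuting with every `ρ h` (e.g. `h₁` central) and `χ h₁ ≠ c h₁`.  Then the inclusion induces a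
linear ISOMORPHISM `Coinv (ρ|S′) χ ≃ Coinv ρ χ`, `e [v′] = [v′]`.  Inverse: `[v] ↦ (χ h₁ − c h₁)⁻¹ • [ρ h₁ v − c h₁ • v]`
(well defined on relations because `ρ h₁` commutes with `ρ h`; two-sided inverse because `[ρ h₁ v − c h₁ • v] =
(χ h₁ − c h₁) • [v]` in either coinvariant space). [cite: MoeglinVignerasWaldspurger1987, Chap. 3 §III.7 a)]
[cite: BernsteinZelevinsky1976, §2.3] -/
theorem exists_linearEquiv_coinv_subrepresentation_of_ne (c : H →* kˣ)
    (hquot : ∀ (h : H) (v : S), ρ h v - ((c h : kˣ) : k) • v ∈ S'.toSubmodule) {h₁ : H}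
    (hcomm : ∀ h : H, Commute (ρ h₁) (ρ h)) (hne : χ h₁ ≠ c h₁) :
    ∃ e : Coinv S'.toRepresentation χ ≃ₗ[k] Coinv ρ χ,
      ∀ v' : S'.toSubmodule, e (mk S'.toRepresentation χ v') = mk ρ χ (v' : S) := by
  -- the scalar `d = χ h₁ - c h₁ ≠ 0`
  set d : k := ((χ h₁ : kˣ) : k) - ((c h₁ : kˣ) : k) with hd_def
  have hd : d ≠ 0 := by
    rw [hd_def, sub_ne_zero]
    exact fun h => hne (Units.ext h)
  -- forward: `[v′] ↦ [v′]`
  let f : Coinv S'.toRepresentation χ →ₗ[k] Coinv ρ χ :=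
    lift S'.toRepresentation χ (mk ρ χ ∘ₗ S'.toSubmodule.subtype) (fun h v' => by
      change mk ρ χ ((S'.toRepresentation h v' : S'.toSubmodule) : S) = _ • mk ρ χ (v' : S)
      rw [coe_toRepresentation_apply, mk_ρW])
  have hf : ∀ v' : S'.toSubmodule, f (mk S'.toRepresentation χ v') = mk ρ χ (v' : S) := fun v' => rfl
  -- the transfer operator `A = ρ h₁ - c h₁`, valued in `S′`
  let A : S →ₗ[k] S'.toSubmodule :=
    LinearMap.codRestrict S'.toSubmodule (ρ h₁ - ((c h₁ : kˣ) : k) • LinearMap.id) (fun v => hquot h₁ v)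
  have hA : ∀ v : S, (A v : S) = ρ h₁ v - ((c h₁ : kˣ) : k) • v := fun v => rfl
  -- `A` intertwines: `A (ρ h v) = ρ h (A v)` (as vectors of `S′`)
  have hAρ : ∀ (h : H) (v : S), A (ρ h v) = S'.toRepresentation h (A v) := by
    intro h v
    apply Subtype.ext
    rw [coe_toRepresentation_apply, hA, hA, map_sub, map_smul]
    congr 1
    exact LinearMap.ext_iff.mp (hcomm h).eq v
  -- backward: `[v] ↦ d⁻¹ • [A v]`
  let g : Coinv ρ χ →ₗ[k] Coinv S'.toRepresentation χ :=
    lift ρ χ (d⁻¹ • (mk S'.toRepresentation χ ∘ₗ A)) (fun h v => by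
      rw [LinearMap.smul_apply, LinearMap.smul_apply, LinearMap.comp_apply, LinearMap.comp_apply, hAρ, mk_ρW,
        smul_comm])
  have hg : ∀ v : S, g (mk ρ χ v) = d⁻¹ • mk S'.toRepresentation χ (A v) := fun v => rfl
  -- `[A v′] = d • [v′]` in `Coinv (ρ|S′)` for `v′ ∈ S′`
  have hAS' : ∀ v' : S'.toSubmodule,
      mk S'.toRepresentation χ (A (v' : S)) = d • mk S'.toRepresentation χ v' := by
    intro v'
    have h1 : A (v' : S) = S'.toRepresentation h₁ v' - ((c h₁ : kˣ) : k) • v' := by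
      apply Subtype.ext
      rw [hA, Submodule.coe_sub, Submodule.coe_smul, coe_toRepresentation_apply]
    rw [h1, map_sub, map_smul, mk_ρW, hd_def, sub_smul]
  -- `[A v] = d • [v]` in `Coinv ρ`
  have hAS : ∀ v : S, mk ρ χ (A v : S) = d • mk ρ χ v := by
    intro v
    rw [hA, map_sub, map_smul, mk_ρW, hd_def, sub_smul]
  have hgf : g ∘ₗ f = LinearMap.id := by
    refine ext_mk S'.toRepresentation χ fun v' => ?_
    rw [LinearMap.comp_apply, hf, hg, hAS', smul_smul, inv_mul_cancel₀ hd, one_smul, LinearMap.id_apply]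
  have hfg : f ∘ₗ g = LinearMap.id := by
    refine ext_mk ρ χ fun v => ?_
    rw [LinearMap.comp_apply, hg, map_smul, hf, hAS, smul_smul, inv_mul_cancel₀ hd, one_smul, LinearMap.id_apply]
  exact ⟨LinearEquiv.ofLinear f g hfg hgf, hf⟩

/-- **Equivariance transfer.**  An isomorphism `e : Coinv (ρ|S′) χ ≃ Coinv ρ χ` with `e [v′] = [v′]` intertwines any two
operators `T′`, `T` of the coinvariant spaces that are induced (`T′ [v′] = [u′ v′]`, `T [v] = [u v]`) by one operator `u` of
`S` restricting to `u′` on `S′` — e.g. `T′ = rep χ ρV′ _ g`, `T = rep χ ρV _ g` for a representation `ρV` commuting with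
`ρ(H)` and preserving `S′` (`rep_mk`). [cite: MoeglinVignerasWaldspurger1987, Chap. 3 §III.7 a)] -/
theorem equivariant_of_comp_mk (e : Coinv S'.toRepresentation χ ≃ₗ[k] Coinv ρ χ)
    (he : ∀ v' : S'.toSubmodule, e (mk S'.toRepresentation χ v') = mk ρ χ (v' : S))
    (T' : Coinv S'.toRepresentation χ →ₗ[k] Coinv S'.toRepresentation χ) (T : Coinv ρ χ →ₗ[k] Coinv ρ χ)
    (u' : S'.toSubmodule →ₗ[k] S'.toSubmodule) (u : S →ₗ[k] S) (hu : ∀ v' : S'.toSubmodule, ((u' v' : S'.toSubmodule) : S) = u v')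
    (hT' : ∀ v' : S'.toSubmodule, T' (mk S'.toRepresentation χ v') = mk S'.toRepresentation χ (u' v'))
    (hT : ∀ v : S, T (mk ρ χ v) = mk ρ χ (u v)) : ∀ x, e (T' x) = T (e x) := by
  intro x
  obtain ⟨v', rfl⟩ := mk_surjective S'.toRepresentation χ x
  rw [hT', he, he, hT, hu]

/-! ### With a commuting representation of a second group: the `rep`-equivariant form -/

/-- **The `rep`-equivariant form.**  Let `ρV : Representation k G S` commute with `ρW : Representation k H S`, let
`S′` be a `ρW`-subrepresentation that is ALSO `ρV(G)`-stable, with `H` acting on `S ⧸ S′` through `c`, and `χ h₁ ≠ c h₁`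
for some `h₁` with `ρW h₁` commuting with `ρW(H)`.  Then: the restriction `ρV′` of `ρV` to `S′` commutes with `ρW|S′`, and
the isomorphism `e : Coinv (ρW|S′) χ ≃ Coinv ρW χ`, `e [v′] = [v′]`, of
`exists_linearEquiv_coinv_subrepresentation_of_ne` INTERTWINES the representations `TwistedCoinv.rep χ ρV′ _` and
`TwistedCoinv.rep χ ρV _` of `G` on the two coinvariant spaces — i.e. `rep χ ρV′ _ ≅ rep χ ρV _` as `G`-representations
(the `χ`-coinvariants of a dual-pair-type module do not see a `c`-isotypic quotient). [cite: MoeglinVignerasWaldspurger1987, Chap. 3 §III.7 a)]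
[cite: BernsteinZelevinsky1976, §2.3] -/
theorem exists_rep_equivariant_linearEquiv_of_ne {G : Type*} [Group G] (ρV : Representation k G S)
    (hc : ∀ (g : G) (h : H), Commute (ρV g) (ρ h))
    (hV : ∀ (g : G) (v : S), v ∈ S'.toSubmodule → ρV g v ∈ S'.toSubmodule) (c : H →* kˣ)
    (hquot : ∀ (h : H) (v : S), ρ h v - ((c h : kˣ) : k) • v ∈ S'.toSubmodule) {h₁ : H}
    (hcomm : ∀ h : H, Commute (ρ h₁) (ρ h)) (hne : χ h₁ ≠ c h₁) :
    ∃ (ρV' : Representation k G S'.toSubmodule)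
      (hc' : ∀ (g : G) (h : H), Commute (ρV' g) (S'.toRepresentation h))
      (e : Coinv S'.toRepresentation χ ≃ₗ[k] Coinv ρ χ),
      (∀ (g : G) (v' : S'.toSubmodule), ((ρV' g v' : S'.toSubmodule) : S) = ρV g v') ∧
      (∀ v' : S'.toSubmodule, e (mk S'.toRepresentation χ v') = mk ρ χ (v' : S)) ∧
      ∀ (g : G) (x : Coinv S'.toRepresentation χ), e (rep χ ρV' hc' g x) = rep χ ρV hc g (e x) := by
  -- the restriction of `ρV` to `S′`
  let ρV' : Representation k G S'.toSubmodule :=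
    { toFun := fun g => (ρV g).restrict (hV g)
      map_one' := by
        apply LinearMap.ext; intro v'; apply Subtype.ext
        change ρV 1 (v' : S) = (v' : S)
        rw [map_one, Module.End.one_apply]
      map_mul' := fun g g' => by
        apply LinearMap.ext; intro v'; apply Subtype.ext
        change ρV (g * g') (v' : S) = ρV g (ρV g' (v' : S))
        rw [map_mul, Module.End.mul_apply] }
  have hρV' : ∀ (g : G) (v' : S'.toSubmodule), ((ρV' g v' : S'.toSubmodule) : S) = ρV g v' := fun g v' => rfl
  have hc' : ∀ (g : G) (h : H), Commute (ρV' g) (S'.toRepresentation h) := by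
    intro g h
    refine LinearMap.ext fun v' => Subtype.ext ?_
    change ((ρV' g (S'.toRepresentation h v') : S'.toSubmodule) : S) =
      ((S'.toRepresentation h (ρV' g v') : S'.toSubmodule) : S)
    rw [hρV', coe_toRepresentation_apply, coe_toRepresentation_apply, hρV']
    exact LinearMap.ext_iff.mp (hc g h).eq v'
  obtain ⟨e, he⟩ := exists_linearEquiv_coinv_subrepresentation_of_ne ρ χ S' c hquot hcomm hne
  refine ⟨ρV', hc', e, hρV', he, fun g => ?_⟩
  exact equivariant_of_comp_mk ρ χ S' e he (rep χ ρV' hc' g) (rep χ ρV hc g) (ρV' g) (ρV g) (hρV' g)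
    (fun v' => rep_mk χ ρV' hc' g v') (fun v => rep_mk χ ρV hc g v)

/-! ### Submodule-level form (no quotient types): the two halves for a bare submodule `S′` -/

/-- **Surjectivity half, submodule form.**  If `ρ h₁ v − c₁ • v ∈ S′` for all `v` (the group element `h₁` acts on `S ⧸ S′` by
the scalar `c₁`) and `χ h₁ ≠ c₁`, every vector is congruent to a vector of `S′` modulo the `χ`-relations:
`v − v′ ∈ TwistedCoinv.ker ρ χ` with `v′ = (χ h₁ − c₁)⁻¹ • (ρ h₁ v − c₁ • v) ∈ S′`.  (No stability of `S′` is needed.)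
[cite: MoeglinVignerasWaldspurger1987, Chap. 3 §III.7 a)] -/
theorem exists_sub_mem_ker_of_ne (T : Submodule k S) {h₁ : H} (c₁ : k) (hquot : ∀ v : S, ρ h₁ v - c₁ • v ∈ T)
    (hne : ((χ h₁ : kˣ) : k) ≠ c₁) (v : S) : ∃ v' ∈ T, v - v' ∈ ker ρ χ := by
  have hd : ((χ h₁ : kˣ) : k) - c₁ ≠ 0 := sub_ne_zero.mpr hne
  refine ⟨(((χ h₁ : kˣ) : k) - c₁)⁻¹ • (ρ h₁ v - c₁ • v), T.smul_mem _ (hquot v), ?_⟩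
  have h1 : v - (((χ h₁ : kˣ) : k) - c₁)⁻¹ • (ρ h₁ v - c₁ • v) =
      (((χ h₁ : kˣ) : k) - c₁)⁻¹ • ((((χ h₁ : kˣ) : k) - c₁) • v - (ρ h₁ v - c₁ • v)) := by
    rw [smul_sub (((χ h₁ : kˣ) : k) - c₁)⁻¹ ((((χ h₁ : kˣ) : k) - c₁) • v), smul_smul, inv_mul_cancel₀ hd, one_smul]
  have h2 : (((χ h₁ : kˣ) : k) - c₁) • v - (ρ h₁ v - c₁ • v) = -(ρ h₁ v - ((χ h₁ : kˣ) : k) • v) := by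
    rw [sub_smul]; abel
  rw [h1, h2, smul_neg]
  exact (ker ρ χ).neg_mem ((ker ρ χ).smul_mem _ (sub_mem_ker ρ χ h₁ v))

/-- **Injectivity half, submodule form.**  If `ρ h₁ v − c₁ • v ∈ S′` for all `v`, `ρ h₁` commutes with every `ρ h`, and
`χ h₁ ≠ c₁`, then a vector OF `S′` that is a `χ`-relation in `S` is already a `χ`-relation built from vectors of `S′`:
`S′ ∩ span {ρ h w − χ h • w | w ∈ S} ⊆ span {ρ h w′ − χ h • w′ | w′ ∈ S′}`.  Proof: the operator `A = ρ h₁ − c₁` maps `S` into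
`S′` and relations to `S′`-relations (it commutes with `ρ h`), and `A v = (ρ h₁ v − χ h₁ • v) + (χ h₁ − c₁) • v`.  (No
stability of `S′` under `ρ` is needed.) [cite: MoeglinVignerasWaldspurger1987, Chap. 3 §III.7 a)] [cite: BernsteinZelevinsky1976, §2.3] -/
theorem mem_span_of_mem_ker_of_ne (T : Submodule k S) {h₁ : H} (c₁ : k) (hquot : ∀ v : S, ρ h₁ v - c₁ • v ∈ T)
    (hcomm : ∀ h : H, Commute (ρ h₁) (ρ h)) (hne : ((χ h₁ : kˣ) : k) ≠ c₁) {v : S} (hvT : v ∈ T) (hv : v ∈ ker ρ χ) :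
    v ∈ Submodule.span k (Set.range fun hw : H × T => ρ hw.1 (hw.2 : S) - ((χ hw.1 : kˣ) : k) • (hw.2 : S)) := by
  set K₀ : Submodule k S :=
    Submodule.span k (Set.range fun hw : H × T => ρ hw.1 (hw.2 : S) - ((χ hw.1 : kˣ) : k) • (hw.2 : S)) with hK₀
  have hd : ((χ h₁ : kˣ) : k) - c₁ ≠ 0 := sub_ne_zero.mpr hne
  -- the operator `A = ρ h₁ - c₁`
  let A : S →ₗ[k] S := ρ h₁ - c₁ • LinearMap.id
  have hA : ∀ w : S, A w = ρ h₁ w - c₁ • w := fun w => rfl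
  have hAρ : ∀ (h : H) (w : S), A (ρ h w) = ρ h (A w) := by
    intro h w
    rw [hA, hA, map_sub, map_smul]
    congr 1
    exact LinearMap.ext_iff.mp (hcomm h).eq w
  -- `A` maps the `χ`-relations of `S` into the `χ`-relations of `S′`
  have hmap : (ker ρ χ).map A ≤ K₀ := by
    rw [ker, Submodule.map_span_le]
    rintro _ ⟨⟨h, w⟩, rfl⟩
    have hgen : A (ρ h w - ((χ h : kˣ) : k) • w) = ρ h (A w) - ((χ h : kˣ) : k) • A w := by
      rw [map_sub, map_smul, hAρ]
    rw [hgen]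
    exact Submodule.subset_span ⟨(h, ⟨A w, hquot w⟩), rfl⟩
  have h1 : A v ∈ K₀ := hmap ⟨v, hv, rfl⟩
  have h2 : ρ h₁ v - ((χ h₁ : kˣ) : k) • v ∈ K₀ := Submodule.subset_span ⟨(h₁, ⟨v, hvT⟩), rfl⟩
  have h3 : (((χ h₁ : kˣ) : k) - c₁) • v = A v - (ρ h₁ v - ((χ h₁ : kˣ) : k) • v) := by
    rw [hA, sub_smul]; abel
  rw [← Submodule.smul_mem_iff K₀ hd, h3]
  exact K₀.sub_mem h1 h2

end Literature.RepresentationTheory.TwistedCoinv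

end
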